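import Summits.CriticalPhenomena.PercolationContinuityZ3.Theorems.PercNearOneGluingNoHeavyLowerTailCumulativeIsolation
import Summits.CriticalPhenomena.PercolationContinuityZ3.Theorems.PercNearOneGluingNoHeavyLowerTailGuardedCIL
import HarnessLib

/-!
# `NoHeavyLowerTail` (stmt-CriticalPhenomena-4575) — the GUARDED cumulative isolation lemma, every level

Support file (`--supports stmt-CriticalPhenomena-4575`), prover `prim-ineq-gen-6` (gen 10).  No definitions, no named
facts, no sorries; standard axioms.

Bond percolation `μ = prodBernoulli w` on `Fin n`, relays `A`, observer `o`, level `j`; `π(v) = C(v) ∩ A`, `N = |π(o)|`,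
`L = {1 ≤ N ≤ j}`, `R_a = {|π(a)| ≤ j}`, `𝔸 = {o ↔ A}`, and the GUARD `Big(v) = {∃ b ∈ A, v ↮ b, |π(b)| > j}` ("some
open cluster other than `C(v)` holds more than `j` relays").  The lead's registered stub `stub_guardedCIL` (gen 2;
"GCIL_j, 0 violations (5,2),(6,3),(7,3),(6,2),(7,2)") asks for a relay `a` with

  `μ(L ∩ Big(o)) ≤ μ(R_a ∩ Big(a))`.

THIS FILE PROVES IT for every level-`j` champion `c` (a maximiser of `μ(R_·)` over `A`), from the attached-champion
inequality XZ `μ(L) ≤ μ(𝔸 ∩ R_c)` (`CIL.lowerTail_le_inter`, this seat, a corollary of Kozma–Nitzan's Conjecture 4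
`Q7Psi.kn_conj4_designated`): the unguarded remainders compare the other way by pure bookkeeping,
`(𝔸 ∩ R_c) ∖ Big(c) ⊆ L ∖ Big(o)` (`GuardedCILHolds.attached_small_noGuard_subset`: with no big cluster away from
`C(c)` and `|π(c)| ≤ j`, every block has `≤ j` relays), so
`μ(L ∩ Big(o)) = μ(L) − μ(L ∖ Big(o)) ≤ μ(𝔸 ∩ R_c) − μ((𝔸 ∩ R_c) ∖ Big(c)) = μ(𝔸 ∩ R_c ∩ Big(c)) ≤ μ(R_c ∩ Big(c))`.
[cite: KozmaNitzan2024, Conjecture 4 (p. 32), Lemma 2 (p. 6)]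
-/

noncomputable section

namespace Summit.CriticalPhenomena.PercolationContinuityZ3.Theorems

open MeasureTheory Set Literature.Probability.LatticeModels Literature.Probability.Percolation
open scoped Classical

namespace GuardedCILHolds

variable {n : ℕ}

/-- **Bookkeeping for the guard.**  If `o ↔ A`, `|π(c)| ≤ j` and no cluster other than `C(c)` holds more than `j`
relays, then `1 ≤ N ≤ j` and no cluster other than `C(o)` holds more than `j` relays:
`(𝔸 ∩ R_c) ∖ Big(c) ⊆ L ∖ Big(o)`. [folklore] -/
theorem attached_small_noGuard_subset (A : Finset (Fin n)) (o c : Fin n) (j : ℕ) :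
    (((⋃ a' ∈ A, (openConn o a' : Set (BondConfig (Fin n)))) ∩
        {ω : BondConfig (Fin n) | (A.filter fun z => ω ∈ openConn c z).card ≤ j}) \
      {ω | ∃ b ∈ A, ω ∉ openConn c b ∧ j < (A.filter fun z => ω ∈ openConn b z).card}) ⊆
    ({ω : BondConfig (Fin n) | 1 ≤ (A.filter fun z => ω ∈ openConn o z).card ∧
        (A.filter fun z => ω ∈ openConn o z).card ≤ j} \
      {ω | ∃ b ∈ A, ω ∉ openConn o b ∧ j < (A.filter fun z => ω ∈ openConn b z).card}) := by
  intro ω hω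
  rw [Set.mem_sdiff, Set.mem_inter_iff, Set.mem_setOf_eq, Set.mem_setOf_eq] at hω
  obtain ⟨⟨hU, hRc⟩, hnoBig⟩ := hω
  push Not at hnoBig
  -- every relay's block has at most `j` relays
  have hsmall : ∀ b ∈ A, (A.filter fun z => ω ∈ openConn b z).card ≤ j := by
    intro b hb
    by_cases hcb : ω ∈ openConn c b
    · rw [GuardedCIL.filter_eq_of_reachable A hcb]; exact hRc
    · exact hnoBig b hb hcb
  have hN1 : 1 ≤ (A.filter fun z => ω ∈ openConn o z).card := (CIL.mem_iUnion_openConn_iff A o ω).1 hU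
  rw [Set.mem_sdiff, Set.mem_setOf_eq, Set.mem_setOf_eq]
  refine ⟨⟨hN1, ?_⟩, ?_⟩
  · -- `N ≤ j`: `o` is joined to some relay `a'`, and `π(o) = π(a')`
    obtain ⟨a', ha', hoa'⟩ := Set.mem_iUnion₂.1 hU
    rw [← GuardedCIL.filter_eq_of_reachable A hoa']
    exact hsmall a' ha'
  · push Not
    intro b hb _
    exact hsmall b hb

/-- **The guarded CIL at a champion.**  For every level-`j` champion `c ∈ A` (`μ(R_a) ≤ μ(R_c)` for all `a ∈ A`):
`μ(L ∩ Big(o)) ≤ μ(R_c ∩ Big(c))`. [this work] [cite: KozmaNitzan2024, Conjecture 4 (p. 32)] -/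
theorem guardedCIL_champion (w : Sym2 (Fin n) → unitInterval) (A : Finset (Fin n)) (o c : Fin n) (j : ℕ)
    (hcA : c ∈ A)
    (hcmax : ∀ a ∈ A,
      (prodBernoulli w).real {ω : BondConfig (Fin n) | (A.filter fun x => ω ∈ openConn a x).card ≤ j} ≤
        (prodBernoulli w).real {ω : BondConfig (Fin n) | (A.filter fun x => ω ∈ openConn c x).card ≤ j}) :
    (prodBernoulli w).real
        ({ω : BondConfig (Fin n) | 1 ≤ (A.filter fun z => ω ∈ openConn o z).card ∧
            (A.filter fun z => ω ∈ openConn o z).card ≤ j} ∩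
          {ω | ∃ b ∈ A, ω ∉ openConn o b ∧ j < (A.filter fun z => ω ∈ openConn b z).card}) ≤
      (prodBernoulli w).real
        ({ω : BondConfig (Fin n) | (A.filter fun z => ω ∈ openConn c z).card ≤ j} ∩
          {ω | ∃ b ∈ A, ω ∉ openConn c b ∧ j < (A.filter fun z => ω ∈ openConn b z).card}) := by
  set μ := prodBernoulli w with hμ
  haveI : IsProbabilityMeasure μ := by rw [hμ]; infer_instance
  have hmeas : ∀ S : Set (BondConfig (Fin n)), MeasurableSet S := fun _ => MeasurableSet.of_discrete
  set L : Set (BondConfig (Fin n)) := {ω | 1 ≤ (A.filter fun z => ω ∈ openConn o z).card ∧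
    (A.filter fun z => ω ∈ openConn o z).card ≤ j} with hL
  set Rc : Set (BondConfig (Fin n)) := {ω | (A.filter fun z => ω ∈ openConn c z).card ≤ j} with hRc
  set U : Set (BondConfig (Fin n)) := ⋃ a' ∈ A, (openConn o a' : Set (BondConfig (Fin n))) with hU
  set Bo : Set (BondConfig (Fin n)) :=
    {ω | ∃ b ∈ A, ω ∉ openConn o b ∧ j < (A.filter fun z => ω ∈ openConn b z).card} with hBo
  set Bc : Set (BondConfig (Fin n)) :=
    {ω | ∃ b ∈ A, ω ∉ openConn c b ∧ j < (A.filter fun z => ω ∈ openConn b z).card} with hBc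
  have hXZ : μ.real L ≤ μ.real (U ∩ Rc) := CIL.lowerTail_le_inter w A o c j hcA hcmax
  have h1 := measureReal_inter_add_sdiff (μ := μ) (s := L) (t := Bo) (hmeas _) (measure_ne_top μ _)
  have h2 := measureReal_inter_add_sdiff (μ := μ) (s := U ∩ Rc) (t := Bc) (hmeas _) (measure_ne_top μ _)
  have h3 : μ.real ((U ∩ Rc) \ Bc) ≤ μ.real (L \ Bo) :=
    measureReal_mono (attached_small_noGuard_subset A o c j) (measure_ne_top μ _)
  have h4 : μ.real (U ∩ Rc ∩ Bc) ≤ μ.real (Rc ∩ Bc) :=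
    measureReal_mono (fun ω hω => ⟨hω.1.2, hω.2⟩) (measure_ne_top μ _)
  linarith

/-- **The registered stub `stub_guardedCIL` of the lead's line (gen 2), verbatim** — the GUARDED cumulative isolation
lemma at every level `j`: some relay `a ∈ A` (any level-`j` champion) satisfies `μ(L ∩ Big(o)) ≤ μ(R_a ∩ Big(a))`.
[this work] [cite: KozmaNitzan2024, Conjecture 4 (p. 32), Lemma 2 (p. 6)] -/
theorem stub_guardedCIL :
    ∀ (n : ℕ) (w : Sym2 (Fin n) → unitInterval) (A : Finset (Fin n)) (o : Fin n) (j : ℕ), A.Nonempty → o ∉ A →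
      ∃ a ∈ A, (Literature.Probability.LatticeModels.prodBernoulli w).real
          ({ω : Literature.Probability.Percolation.BondConfig (Fin n) |
              1 ≤ (A.filter fun z => ω ∈ Literature.Probability.Percolation.openConn o z).card ∧
                (A.filter fun z => ω ∈ Literature.Probability.Percolation.openConn o z).card ≤ j} ∩
            {ω | ∃ b ∈ A, ω ∉ Literature.Probability.Percolation.openConn o b ∧
              j < (A.filter fun z => ω ∈ Literature.Probability.Percolation.openConn b z).card}) ≤
        (Literature.Probability.LatticeModels.prodBernoulli w).real
          ({ω : Literature.Probability.Percolation.BondConfig (Fin n) |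
              (A.filter fun z => ω ∈ Literature.Probability.Percolation.openConn a z).card ≤ j} ∩
            {ω | ∃ b ∈ A, ω ∉ Literature.Probability.Percolation.openConn a b ∧
              j < (A.filter fun z => ω ∈ Literature.Probability.Percolation.openConn b z).card}) := by
  intro n w A o j hA _
  obtain ⟨c, hcA, hcmax⟩ := Finset.exists_max_image A
    (fun a => (prodBernoulli w).real {ω : BondConfig (Fin n) | (A.filter fun x => ω ∈ openConn a x).card ≤ j}) hA
  exact ⟨c, hcA, guardedCIL_champion w A o c j hcA hcmax⟩

end GuardedCILHolds

end Summit.CriticalPhenomena.PercolationContinuityZ3.Theorems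

end
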